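import Mathlib
import Summits.Ventures.PercRepro2.SwOutCrossGenBitThm
import Summits.Ventures.PercRepro2.SwOutCrossGenKEEdge

/-!
# The fibre data with an extra vertex for every connected cross component (blind cell
PercRepro2, night-4 g24, 2026-08-28; proofs/NIGHT4-G24.md §9)

The injection `thetaKE` of EVERY non-red-leaking fibre point of a connected cross component
(g23's `psiKE` on the non-core non-exceptional points; the exceptional points — all dropped, all
outside edges blue — to the all-attached-blue-outside points; the lower core points — all
dropped, red outside — to the all-attached-red-outside points; the upper core points to their
flips with the cross colours kept): it lands in the non-blue-leaking points, with a better label,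
its flip carrying the red edge atoms, and it is injective (the three special families are told
apart by their u-edge and outside bits, and `psiKE`'s images avoid them).  Hence **`fibKEEBit`**
is a `FibreDataBit` and **`card_le_crossKEEBit`** is the abstract theorem of boundary (iv) for a
connected component with one extra dropped vertex.
-/

namespace Summit.Ventures.PercRepro2

namespace CrossArm

open Classical

variable {V : Type*} (G : SimpleGraph V)

section Theta

/-- Everything dropped with blue outside edges (the exceptional points). -/
def ExcKE (w : FibKE V G) : Prop := (∀ i, w.1 i = false) ∧ ∀ i, w.2.2 i = true

/-- Everything dropped with red outside edges (the lower core points). -/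
def C0KE (w : FibKE V G) : Prop := (∀ i, w.1 i = false) ∧ ∀ i, w.2.2 i = false

/-- Everything attached with blue outside edges (the upper core points). -/
def C1KE (w : FibKE V G) : Prop := (∀ i, w.1 i = true) ∧ ∀ i, w.2.2 i = true

/-- **The injection of every non-red-leaking point.** -/
noncomputable def thetaKE (w : FibKE V G) : FibKE V G :=
  if ExcKE G w then (fun _ => true, w.2.1, fun _ => true)
  else if C0KE G w then (fun _ => true, w.2.1, fun _ => false)
  else if C1KE G w then (fun _ => false, fun s => !w.2.1 s, fun _ => false)
  else psiKE G w

/-- With every u-edge red any two vertices are linked. -/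
lemma rlinkE_of_uP_true {w : FibKE V G} (h : ∀ i, w.1 i = true) (i j : V) : rlinkE G w i j :=
  SimpleGraph.Reachable.trans (attE_of_uP G (h i)) (SimpleGraph.Reachable.symm (attE_of_uP G (h j)))

/-- Without red u-edges a linked pair is linked without `u`: we only need that an unattached
vertex is not linked to `u` — `not_attE_of_uP_false`. -/
lemma coreKE_of_C0 {w : FibKE V G} (h : C0KE G w) : coreKE w = true :=
  (coreKE_eq_true_iff w).2 ⟨false, h.1, h.2⟩

/-- An upper core point is core. -/
lemma coreKE_of_C1 {w : FibKE V G} (h : C1KE G w) : coreKE w = true :=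
  (coreKE_eq_true_iff w).2 ⟨true, h.1, h.2⟩

/-- A non-leaking point that is neither exceptional nor a core point is not core. -/
lemma coreKE_eq_false_of_not {w : FibKE V G} (h0 : ¬ C0KE G w) (h1 : ¬ C1KE G w) :
    coreKE w = false := by
  cases hc : coreKE w with
  | false => rfl
  | true =>
    obtain ⟨b, huP, he⟩ := (coreKE_eq_true_iff w).1 hc
    cases b with
    | false => exact absurd ⟨huP, he⟩ h0
    | true => exact absurd ⟨huP, he⟩ h1

/-- The images of the generic branch avoid the three special forms. -/
lemma psiKE_not_special {w : FibKE V G} (hr : leakKE G w = false)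
    (hex : ¬ ExcKE G w) (h0 : ¬ C0KE G w) (h1 : ¬ C1KE G w) :
    ¬ ((∀ i, (psiKE G w).1 i = true) ∧ ∀ i, (psiKE G w).2.2 i = true) ∧
    ¬ ((∀ i, (psiKE G w).1 i = true) ∧ ∀ i, (psiKE G w).2.2 i = false) ∧
    ¬ ((∀ i, (psiKE G w).1 i = false) ∧ ∀ i, (psiKE G w).2.2 i = false) := by
  rw [leakKE_eq_false_iff] at hr
  rw [psiKE_generic G hex]
  simp only [Bool.not_eq_true', Bool.not_eq_false', Bool.and_eq_true, Bool.and_eq_false_iff,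
    decide_eq_true_eq, decide_eq_false_iff_not]
  refine ⟨?_, ?_, ?_⟩
  · rintro ⟨huP, he⟩
    exact hex ⟨huP, fun i => (he i).1⟩
  · rintro ⟨huP, he⟩
    refine h0 ⟨huP, fun i => ?_⟩
    rcases he i with h | h
    · exact h
    · exact absurd h (not_attE_of_uP_false G huP i)
  · rintro ⟨huP, he⟩
    refine h1 ⟨huP, fun i => hr i (attE_of_uP G (huP i))⟩

/-- **`thetaKE` lands in the non-blue-leaking points, with a better label, its flip carrying the
red edge atoms.** -/
theorem thetaKE_ok [Nonempty V] (w : FibKE V G) (hr : leakKE G w = false) :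
    leakKE G (thetaKE G w).flip = false ∧ BetterKE (labelKE G (thetaKE G w)) (labelKE G w) ∧
      ∀ a, redKEE G w a = true → redKEE G (thetaKE G w).flip a = true := by
  by_cases hex : ExcKE G w
  · -- the exceptional point: all dropped, blue outside ↦ all attached, blue outside
    simp only [thetaKE, if_pos hex]
    refine ⟨?_, ?_, ?_⟩
    · rw [leakKE_eq_false_iff]
      intro i hi
      exact absurd hi (not_attE_of_uP_false G (fun _ => rfl) i)
    · dsimp only [BetterKE, labelKE]
      refine ⟨fun i h => ?_, fun i j h => ?_, fun i j h => ?_⟩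
      · exact absurd h (by rw [hex.2 i]; exact Bool.noConfusion)
      · obtain ⟨h1, -, -⟩ := h
        exact absurd h1 (by rw [hex.2 i]; exact Bool.noConfusion)
      · refine ⟨hex.2 i, hex.2 j, ?_⟩
        exact rlinkE_of_uP_true G (w := w.flip) (fun i => by simp [FibKE.flip, hex.1 i]) i j
    · intro a ha
      exfalso
      cases a with
      | inl i =>
        have : w.1 i = true := ha
        rw [hex.1 i] at this; exact Bool.noConfusion this
      | inr s =>
        simp only [redKEE, decide_eq_true_eq] at ha
        obtain ⟨-, i, -, hi⟩ := ha
        exact not_attE_of_uP_false G hex.1 i hi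
  by_cases h0 : C0KE G w
  · -- the lower core point: all dropped, red outside ↦ all attached, red outside
    simp only [thetaKE, if_neg hex, if_pos h0]
    refine ⟨?_, ?_, ?_⟩
    · rw [leakKE_eq_false_iff]
      intro i hi
      exact absurd hi (not_attE_of_uP_false G (fun _ => rfl) i)
    · dsimp only [BetterKE, labelKE]
      refine ⟨fun i _ => rfl, fun i j _ => ?_, fun i j h => ?_⟩
      · exact ⟨rfl, rfl, rlinkE_of_uP_true G (fun _ => rfl) i j⟩
      · obtain ⟨h1, -, -⟩ := h
        exact Bool.noConfusion h1
    · intro a ha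
      exfalso
      cases a with
      | inl i =>
        have : w.1 i = true := ha
        rw [h0.1 i] at this; exact Bool.noConfusion this
      | inr s =>
        simp only [redKEE, decide_eq_true_eq] at ha
        obtain ⟨-, i, -, hi⟩ := ha
        exact not_attE_of_uP_false G h0.1 i hi
  by_cases h1 : C1KE G w
  · -- the upper core point: all attached, blue outside ↦ all dropped, colours flipped, red outside
    simp only [thetaKE, if_neg hex, if_neg h0, if_pos h1]
    refine ⟨?_, ?_, ?_⟩
    · rw [leakKE_eq_false_iff]
      intro i _
      rfl
    · dsimp only [BetterKE, labelKE]
      refine ⟨fun i h => ?_, fun i j h => ?_, fun i j h => ?_⟩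
      · exact absurd h (by rw [h1.2 i]; exact Bool.noConfusion)
      · obtain ⟨h', -, -⟩ := h
        exact absurd h' (by rw [h1.2 i]; exact Bool.noConfusion)
      · obtain ⟨h', -, -⟩ := h
        exact Bool.noConfusion h'
    · intro a ha
      cases a with
      | inl i => rfl
      | inr s =>
        simp only [redKEE, decide_eq_true_eq, FibKE.flip, Bool.not_not] at ha ⊢
        refine ⟨ha.1, ?_⟩
        obtain ⟨i, hi, -⟩ := ha.2
        exact ⟨i, hi, attE_of_uP G rfl⟩
  · -- the generic branch
    simp only [thetaKE, if_neg hex, if_neg h0, if_neg h1]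
    have hc := coreKE_eq_false_of_not G h0 h1
    obtain ⟨hl, -, hlab, -⟩ := psiKE_ok G w hr hc
    exact ⟨hl, hlab, psiKE_red_edge G w⟩

/-- The retraction of `thetaKE`. -/
noncomputable def thetaInvKE (v : FibKE V G) : FibKE V G :=
  if (∀ i, v.1 i = true) ∧ ∀ i, v.2.2 i = true then (fun _ => false, v.2.1, fun _ => true)
  else if (∀ i, v.1 i = true) ∧ ∀ i, v.2.2 i = false then (fun _ => false, v.2.1, fun _ => false)
  else if (∀ i, v.1 i = false) ∧ ∀ i, v.2.2 i = false then (fun _ => true, fun s => !v.2.1 s, fun _ => true)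
  else psiInvKE G v

/-- The retraction recovers every non-red-leaking point. -/
lemma thetaInvKE_thetaKE [Nonempty V] (w : FibKE V G) (hr : leakKE G w = false) :
    thetaInvKE G (thetaKE G w) = w := by
  by_cases hex : ExcKE G w
  · have e : thetaKE G w = (fun _ => true, w.2.1, fun _ => true) := by
      simp only [thetaKE, if_pos hex]
    rw [e]
    unfold thetaInvKE
    rw [if_pos ⟨fun _ => rfl, fun _ => rfl⟩]
    exact Prod.ext (funext fun i => (hex.1 i).symm) (Prod.ext rfl (funext fun i => (hex.2 i).symm))
  by_cases h0 : C0KE G w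
  · have e : thetaKE G w = (fun _ => true, w.2.1, fun _ => false) := by
      simp only [thetaKE, if_neg hex, if_pos h0]
    rw [e]
    unfold thetaInvKE
    rw [if_neg (fun h => Bool.noConfusion (h.2 (Classical.arbitrary V))),
      if_pos ⟨fun _ => rfl, fun _ => rfl⟩]
    exact Prod.ext (funext fun i => (h0.1 i).symm) (Prod.ext rfl (funext fun i => (h0.2 i).symm))
  by_cases h1 : C1KE G w
  · have e : thetaKE G w = (fun _ => false, fun s => !w.2.1 s, fun _ => false) := by
      simp only [thetaKE, if_neg hex, if_neg h0, if_pos h1]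
    rw [e]
    unfold thetaInvKE
    rw [if_neg (fun h => Bool.noConfusion (h.1 (Classical.arbitrary V))),
      if_neg (fun h => Bool.noConfusion (h.1 (Classical.arbitrary V))),
      if_pos ⟨fun _ => rfl, fun _ => rfl⟩]
    refine Prod.ext (funext fun i => (h1.1 i).symm) (Prod.ext ?_ (funext fun i => (h1.2 i).symm))
    funext s
    simp
  · have e : thetaKE G w = psiKE G w := by
      simp only [thetaKE, if_neg hex, if_neg h0, if_neg h1]
    rw [e]
    unfold thetaInvKE
    obtain ⟨n1, n2, n3⟩ := psiKE_not_special G hr hex h0 h1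
    rw [if_neg n1, if_neg n2, if_neg n3]
    exact psiInvKE_psiKE G w hr (coreKE_eq_false_of_not G h0 h1)

/-- **`thetaKE` is injective on the non-red-leaking points.** -/
theorem thetaKE_inj [Nonempty V] (w w' : FibKE V G) (hr : leakKE G w = false) (hr' : leakKE G w' = false)
    (heq : thetaKE G w = thetaKE G w') : w = w' := by
  rw [← thetaInvKE_thetaKE G w hr, heq, thetaInvKE_thetaKE G w' hr']

end Theta

section Instance

variable [Fintype V] [DecidableEq V] [DecidableRel G.Adj] [Nonempty V] (hG : G.Connected)

/-- **The fibre data with an extra vertex for every connected cross component.** -/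
noncomputable def fibKEEBit : FibreDataBit (FibKE V G) (AtomKEE V G) (LabelKE V) :=
  { fibKEE G hG with
    theta := thetaKE G
    theta_ok := thetaKE_ok G
    theta_inj := thetaKE_inj G }

/-- **THE ABSTRACT THEOREM OF BOUNDARY (iv) FOR A CONNECTED COMPONENT WITH ONE EXTRA DROPPED
VERTEX** (any size, any connected cross-edge graph). -/
theorem card_le_crossKEEBit {ι : Type*} [Fintype ι] [DecidableEq ι] [Nonempty ι]
    {𝒯 : Set (TypBG (LabelKE V) ι)} (h𝒯 : IsUpBG (fibKEEBit G hG) 𝒯)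
    {𝓔 : Set (Set (AtomBG (AtomKEE V G) ι))} (h𝓔 : IsUpperSet 𝓔) :
    ((QBG (fibKEEBit G hG) 𝒯).filter fun x => ERBG (fibKEEBit G hG) x ∈ 𝓔).card ≤
      ((QBG (fibKEEBit G hG) 𝒯).filter fun x => EBBG (fibKEEBit G hG) x ∈ 𝓔).card :=
  card_le_crossGenBit (fibKEEBit G hG) h𝒯 h𝓔

end Instance

end CrossArm

end Summit.Ventures.PercRepro2
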